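import Summits.ResolutionOfSingularities.ResolutionOfSingularities.Theorems.EquisingularLiftEquisingularLiftNatHilbertBurchLiftPolynomial
import Literature.AlgebraicGeometry.Motives.HypersurfaceFormsIrreducible
import Mathlib
import HarnessLib

/-!
# [OURS · L1 W4.5(b)] HILBERT–BURCH, PART 4 — FIRST NON-CI INSTANCE: every lift of the Hilbert–Burch matrix of the TWISTED CUBIC
# `((x₀,x₁),(x₁,x₂),(x₂,x₃))` over `O[x₀,…,x₃]` is an `O`-flat deformation of the twisted cubic's homogeneous coordinate ring
# (rung v6′/v6″ «DET-nose»; crux `EquisingularLiftNatThree` = stmt-ResolutionOfSingularities-20148, parent stmt-20038, line `sections`)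

NOT a statement of any manuscript. Helper file of the chain res-L1-w45b (cell `res-hironaka`, rung L, slot W4.5(b));
AI-written, weaker than expert review; filed `--supports stmt-ResolutionOfSingularities-20148 --as helper` (own initiative,
counted 0): a NON-VACUITY certificate for the hypotheses of parts 1–3 (`…NatHilbertBurchComplex/Lift/LiftPolynomial`) in
the first case that is not a complete intersection.

For the matrix `M = ((x₀,x₁),(x₁,x₂),(x₂,x₃)) : Matrix (Fin 3) (Fin 2) k[x₀,…,x₃]` (`k` any field):
* `det_submatrix_twistedCubic_zero/one/two` — the maximal minors are `Δ₀ = x₁x₃ − x₂²`, `Δ₁ = x₀x₃ − x₁x₂`, `Δ₂ = x₀x₂ − x₁²`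
  (the net of quadrics through the twisted cubic `[s³ : s²t : st² : t³]`);
* `prime_X_one_sq_sub` — `x₁² − x₀x₂` is PRIME in `k[x₀,…,x₃]` (Eisenstein form `Y² − y₀y₁` after `x₀ ↔ x₁`, tree
  `SmoothHypersurface.irreducible_X_pow_add_C`; polynomial rings are factorial);
* `X_one_mul_X_three_sub_notMem_span` — `x₁x₃ − x₂² ∉ (x₁² − x₀x₂)` (evaluate at `(0,0,1,0)`), hence
  `mem_span_of_mul_mem_twistedCubic` — `(x₁² − x₀x₂, x₁x₃ − x₂²)` is a REGULAR PAIR inside `I₂(M)`;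
* `exists_mulVec_eq_twistedCubic` — so the Hilbert–Burch complex of `M` is exact in the middle (part 1): every syzygy of
  `(Δ₀, −Δ₁, Δ₂)` is a combination of the two columns of `M`;
* **`flat_quotient_span_minor_of_map_eq_twistedCubic`** — for `O` a DVR with uniformizer `ϖ`, any residue model
  `π : O ↠ k` (`π ϖ = 0`, `ker π ⊆ (ϖ)`) and ANY `M̃ : Matrix (Fin 3) (Fin 2) O[x₀,…,x₃]` reducing to `M`,
  `O[x]/I₂(M̃)` is FLAT over `O` (part 3 `flat_mvPolynomial_quotient_span_minor_of_regular_pair`) — e.g. the trivial lift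
  (`map_twistedCubic`) or any `ϖ`-perturbation of it.
* (rev 2) `jacobian_pair_twistedCubic_x0` / `_x3` — the 2×2 Jacobian minors `x₀²`, `x₃²` of the pairs `(Δ₁,Δ₂)`, `(Δ₁,Δ₀)`;
  `forall_X_mem_of_minors_mem`, `X_zero_notMem_or_X_three_notMem` — a prime through the quadrics missing some variable
  misses `x₀` or `x₃` (the twisted cubic is «Jacobian-pair smooth», preparation for the scheme-level specimen).

References: J. Harris, *Algebraic Geometry: A First Course* (GTM 133), Ex. 1.10 / 9.13 (twisted cubic as a determinantal
variety); D. Eisenbud, GTM 150, §20. Proofs elementary; sources index only.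
-/

set_option linter.dupNamespace false -- mandated namespace `Summit.<Summit>.<Problem>` of this single-conjunct summit
set_option linter.overlappingInstances false -- signatures carry both [IsDomain O] and [IsDiscreteValuationRing O] (Mathlib's class takes the former as a parameter)

namespace Summit.ResolutionOfSingularities.ResolutionOfSingularities.Cruxes.EquisingularLiftNat.Sections

open Matrix MvPolynomial

universe u v

section TwistedCubic

variable (k : Type u) [Field k]

/-! ## The three quadrics -/

/-- `Δ₀(M) = x₁x₃ − x₂²` (delete row 0). [folklore] [OURS · L1 W4.5b] -/
theorem det_submatrix_twistedCubic_zero :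
    ((!![X 0, X 1; X 1, X 2; X 2, X 3] : Matrix (Fin 3) (Fin 2) (MvPolynomial (Fin 4) k)).submatrix
        (0 : Fin 3).succAbove id).det = X 1 * X 3 - X 2 * X 2 := by
  have h0 : (0 : Fin 3).succAbove 0 = 1 := by decide
  have h1 : (0 : Fin 3).succAbove 1 = 2 := by decide
  rw [Matrix.det_fin_two]
  simp only [Matrix.submatrix_apply, id, h0, h1]
  simp

/-- `Δ₁(M) = x₀x₃ − x₁x₂` (delete row 1). [folklore] [OURS · L1 W4.5b] -/
theorem det_submatrix_twistedCubic_one :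
    ((!![X 0, X 1; X 1, X 2; X 2, X 3] : Matrix (Fin 3) (Fin 2) (MvPolynomial (Fin 4) k)).submatrix
        (1 : Fin 3).succAbove id).det = X 0 * X 3 - X 1 * X 2 := by
  have h0 : (1 : Fin 3).succAbove 0 = 0 := by decide
  have h1 : (1 : Fin 3).succAbove 1 = 2 := by decide
  rw [Matrix.det_fin_two]
  simp only [Matrix.submatrix_apply, id, h0, h1]
  simp

/-- `Δ₂(M) = x₀x₂ − x₁²` (delete row 2). [folklore] [OURS · L1 W4.5b] -/
theorem det_submatrix_twistedCubic_two :
    ((!![X 0, X 1; X 1, X 2; X 2, X 3] : Matrix (Fin 3) (Fin 2) (MvPolynomial (Fin 4) k)).submatrix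
        (2 : Fin 3).succAbove id).det = X 0 * X 2 - X 1 * X 1 := by
  have h0 : (2 : Fin 3).succAbove 0 = 0 := by decide
  have h1 : (2 : Fin 3).succAbove 1 = 1 := by decide
  rw [Matrix.det_fin_two]
  simp only [Matrix.submatrix_apply, id, h0, h1]
  simp

/-- `x₁² − x₀x₂ ∈ I₂(M)` (it is `−Δ₂`). [folklore] [OURS · L1 W4.5b] -/
theorem X_one_sq_sub_mem_span_minor :
    (X 1 ^ 2 - X 0 * X 2 : MvPolynomial (Fin 4) k) ∈
      Ideal.span (Set.range fun i : Fin (2 + 1) =>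
        (((!![X 0, X 1; X 1, X 2; X 2, X 3] : Matrix (Fin 3) (Fin 2) (MvPolynomial (Fin 4) k))).submatrix
          i.succAbove id).det) := by
  have h : (X 1 ^ 2 - X 0 * X 2 : MvPolynomial (Fin 4) k) =
      -(((!![X 0, X 1; X 1, X 2; X 2, X 3] : Matrix (Fin 3) (Fin 2) (MvPolynomial (Fin 4) k))).submatrix
          (2 : Fin 3).succAbove id).det := by
    rw [det_submatrix_twistedCubic_two]; ring
  rw [h]
  exact Submodule.neg_mem _ (Ideal.subset_span ⟨2, rfl⟩)

/-- `x₁x₃ − x₂² ∈ I₂(M)` (it is `Δ₀`). [folklore] [OURS · L1 W4.5b] -/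
theorem X_one_mul_X_three_sub_mem_span_minor :
    (X 1 * X 3 - X 2 ^ 2 : MvPolynomial (Fin 4) k) ∈
      Ideal.span (Set.range fun i : Fin (2 + 1) =>
        (((!![X 0, X 1; X 1, X 2; X 2, X 3] : Matrix (Fin 3) (Fin 2) (MvPolynomial (Fin 4) k))).submatrix
          i.succAbove id).det) := by
  have h : (X 1 * X 3 - X 2 ^ 2 : MvPolynomial (Fin 4) k) =
      (((!![X 0, X 1; X 1, X 2; X 2, X 3] : Matrix (Fin 3) (Fin 2) (MvPolynomial (Fin 4) k))).submatrix
          (0 : Fin 3).succAbove id).det := by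
    rw [det_submatrix_twistedCubic_zero]; ring
  rw [h]
  exact Ideal.subset_span ⟨0, rfl⟩

/-! ## The regular pair `(x₁² − x₀x₂, x₁x₃ − x₂²)` -/

/-- After `x₀ ↔ x₁`, `x₁² − x₀x₂` is the Eisenstein form `Y² + C(−y₀y₁)` over `k[y₀, y₁, y₂]`. [folklore] [OURS · L1 W4.5b] -/
theorem finSuccEquiv_rename_X_one_sq_sub :
    finSuccEquiv k 3 (rename (Equiv.swap (0 : Fin 4) 1) (X 1 ^ 2 - X 0 * X 2 : MvPolynomial (Fin 4) k)) =
      Polynomial.X ^ 2 + Polynomial.C (-(X 0 * X 1)) := by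
  have h2 : finSuccEquiv k 3 (X 2) = Polynomial.C (X 1) := finSuccEquiv_X_succ (j := 1)
  simp only [map_sub, map_pow, map_mul, rename_X, Equiv.swap_apply_right, Equiv.swap_apply_left,
    Equiv.swap_apply_of_ne_of_ne (show (2 : Fin 4) ≠ 0 by decide) (show (2 : Fin 4) ≠ 1 by decide),
    finSuccEquiv_X_zero, h2, map_neg, map_mul]
  have h1 : finSuccEquiv k 3 (X 1) = Polynomial.C (X 0) := finSuccEquiv_X_succ (j := 0)
  rw [h1]
  ring

/-- **`x₁² − x₀x₂` is prime in `k[x₀, …, x₃]`** (an irreducible quadric cone; polynomial rings are factorial).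
[folklore; Hartshorne I Ex. 1.1/5.5 style] [OURS · L1 W4.5b] -/
theorem prime_X_one_sq_sub : Prime (X 1 ^ 2 - X 0 * X 2 : MvPolynomial (Fin 4) k) := by
  have hirr : Irreducible (rename (Equiv.swap (0 : Fin 4) 1) (X 1 ^ 2 - X 0 * X 2 : MvPolynomial (Fin 4) k)) := by
    rw [← MulEquiv.irreducible_iff (finSuccEquiv k 3), finSuccEquiv_rename_X_one_sq_sub]
    refine Literature.AlgebraicGeometry.Motives.SmoothHypersurface.irreducible_X_pow_add_C (by norm_num) _
      ![0, 1, 0] ?_ 0 ?_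
    · simp
    · have h : (pderiv 0 : Derivation k (MvPolynomial (Fin 3) k) (MvPolynomial (Fin 3) k)) (-(X 0 * X 1)) =
          -X 1 := by
        rw [map_neg, Derivation.leibniz, pderiv_X_self, pderiv_X_of_ne (show (1 : Fin 3) ≠ 0 by decide), smul_zero,
          zero_add, smul_eq_mul, mul_one]
      rw [h]
      simp
  have hirr' : Irreducible (X 1 ^ 2 - X 0 * X 2 : MvPolynomial (Fin 4) k) :=
    (MulEquiv.irreducible_iff (renameEquiv k (Equiv.swap (0 : Fin 4) 1)).toMulEquiv
      (x := (X 1 ^ 2 - X 0 * X 2 : MvPolynomial (Fin 4) k))).mp hirr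
  exact UniqueFactorizationMonoid.irreducible_iff_prime.mp hirr'

/-- `x₁x₃ − x₂² ∉ (x₁² − x₀x₂)`: evaluate at `(0, 0, 1, 0)`. [folklore] [OURS · L1 W4.5b] -/
theorem X_one_mul_X_three_sub_notMem_span :
    (X 1 * X 3 - X 2 ^ 2 : MvPolynomial (Fin 4) k) ∉ Ideal.span {(X 1 ^ 2 - X 0 * X 2 : MvPolynomial (Fin 4) k)} := by
  intro h
  obtain ⟨q, hq⟩ := Ideal.mem_span_singleton'.mp h
  have h1 := congrArg (MvPolynomial.eval (![0, 0, 1, 0] : Fin 4 → k)) hq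
  simp [map_mul, map_sub] at h1

/-- **Regular pair.** `x₁x₃ − x₂²` is a non-zero-divisor modulo the prime `x₁² − x₀x₂`:
`(x₁x₃ − x₂²)·y ∈ (x₁² − x₀x₂) ⇒ y ∈ (x₁² − x₀x₂)`. [folklore] [OURS · L1 W4.5b] -/
theorem mem_span_of_mul_mem_twistedCubic (y : MvPolynomial (Fin 4) k)
    (hy : (X 1 * X 3 - X 2 ^ 2) * y ∈ Ideal.span {(X 1 ^ 2 - X 0 * X 2 : MvPolynomial (Fin 4) k)}) :
    y ∈ Ideal.span {(X 1 ^ 2 - X 0 * X 2 : MvPolynomial (Fin 4) k)} := by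
  have hP : (Ideal.span {(X 1 ^ 2 - X 0 * X 2 : MvPolynomial (Fin 4) k)}).IsPrime :=
    (Ideal.span_singleton_prime (prime_X_one_sq_sub k).ne_zero).mpr (prime_X_one_sq_sub k)
  rcases hP.mem_or_mem hy with h | h
  · exact absurd h (X_one_mul_X_three_sub_notMem_span k)
  · exact h

/-- `x₁² − x₀x₂` is a non-zero-divisor of `k[x₀, …, x₃]`. [folklore] [OURS · L1 W4.5b] -/
theorem X_one_sq_sub_mem_nonZeroDivisors :
    (X 1 ^ 2 - X 0 * X 2 : MvPolynomial (Fin 4) k) ∈ nonZeroDivisors (MvPolynomial (Fin 4) k) :=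
  mem_nonZeroDivisors_of_ne_zero (prime_X_one_sq_sub k).ne_zero

/-! ## Consequences: Hilbert–Burch exactness and flat lifts -/

/-- **The Hilbert–Burch complex of the twisted cubic is exact in the middle**: every `c ∈ k[x]³` with `det [M | c] = 0`
(i.e. every syzygy `c₀Δ₀ − c₁Δ₁ + c₂Δ₂ = 0` of the three quadrics) is a combination of the two columns of
`M = ((x₀,x₁),(x₁,x₂),(x₂,x₃))` (part 1 `exists_mulVec_eq_of_det_snoc_eq_zero` with the regular pair).
[folklore; Harris GTM 133 Ex. 9.13] [OURS · L1 W4.5b] -/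
theorem exists_mulVec_eq_twistedCubic (c : Fin (2 + 1) → MvPolynomial (Fin 4) k)
    (hc : (Matrix.of fun i => (Fin.snoc
        ((!![X 0, X 1; X 1, X 2; X 2, X 3] : Matrix (Fin 3) (Fin 2) (MvPolynomial (Fin 4) k)) i) (c i) :
          Fin (2 + 1) → MvPolynomial (Fin 4) k)).det = 0) :
    ∃ w : Fin 2 → MvPolynomial (Fin 4) k,
      (!![X 0, X 1; X 1, X 2; X 2, X 3] : Matrix (Fin 3) (Fin 2) (MvPolynomial (Fin 4) k)) *ᵥ w = c :=
  exists_mulVec_eq_of_det_snoc_eq_zero _ (X_one_sq_sub_mem_span_minor k) (X_one_mul_X_three_sub_mem_span_minor k)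
    (X_one_sq_sub_mem_nonZeroDivisors k) (mem_span_of_mul_mem_twistedCubic k) c hc

variable {k}

/-- **EVERY LIFT OF THE TWISTED CUBIC'S HILBERT–BURCH MATRIX IS A FLAT DEFORMATION.** `O` a DVR with uniformizer `ϖ`,
`π : O ↠ k` a residue model (`π ϖ = 0`, `ker π ⊆ (ϖ)`), `M̃ : Matrix (Fin 3) (Fin 2) O[x₀,…,x₃]` ANY matrix reducing to
`((x₀,x₁),(x₁,x₂),(x₂,x₃))`. Then `O[x₀,…,x₃] ⧸ I₂(M̃)` is flat over `O` (part 3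
`flat_mvPolynomial_quotient_span_minor_of_regular_pair`); its special fibre is the twisted cubic's coordinate ring
(part 3 `comap_span_minor_mvPolynomial`). First non-CI instance of rung v6′/v6″. [folklore, cf. Eisenbud GTM 150 §20]
[OURS · L1 W4.5b] -/
theorem flat_quotient_span_minor_of_map_eq_twistedCubic {O : Type v} [CommRing O] [IsDomain O] [IsDiscreteValuationRing O] {ϖ : O} (hϖ : Irreducible ϖ) (π : O →+* k)
    (hπ : Function.Surjective π) (hπϖ : π ϖ = 0) (hker : ∀ r : O, π r = 0 → r ∈ Ideal.span {ϖ})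
    (M : Matrix (Fin (2 + 1)) (Fin 2) (MvPolynomial (Fin 4) O))
    (hM : M.map (MvPolynomial.map π) =
      (!![X 0, X 1; X 1, X 2; X 2, X 3] : Matrix (Fin 3) (Fin 2) (MvPolynomial (Fin 4) k))) :
    Module.Flat O (MvPolynomial (Fin 4) O ⧸
      Ideal.span (Set.range fun i : Fin (2 + 1) => (M.submatrix i.succAbove id).det)) := by
  refine flat_mvPolynomial_quotient_span_minor_of_regular_pair hϖ π hπ hπϖ hker M ?_ ?_
    (X_one_sq_sub_mem_nonZeroDivisors k) (mem_span_of_mul_mem_twistedCubic k)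
  · rw [hM]; exact X_one_sq_sub_mem_span_minor k
  · rw [hM]; exact X_one_mul_X_three_sub_mem_span_minor k

/-- The trivial lift: the same matrix over `O[x]` reduces to `((x₀,x₁),(x₁,x₂),(x₂,x₃))` over `k[x]`; so do all its
`ker (map π)`-perturbations. [folklore] [OURS · L1 W4.5b] -/
theorem map_twistedCubic {O : Type v} [CommRing O] (π : O →+* k) :
    ((!![X 0, X 1; X 1, X 2; X 2, X 3] : Matrix (Fin 3) (Fin 2) (MvPolynomial (Fin 4) O))).map
        (MvPolynomial.map π) =
      (!![X 0, X 1; X 1, X 2; X 2, X 3] : Matrix (Fin 3) (Fin 2) (MvPolynomial (Fin 4) k)) := by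
  ext i j
  fin_cases i <;> fin_cases j <;> simp [map_X]

/-- A perturbed lift: `((x₀,x₁),(x₁,x₂),(x₂,x₃ + ϖ·h))` reduces to the twisted cubic's matrix for every `h ∈ O[x]` when
`π ϖ = 0`. [folklore] [OURS · L1 W4.5b] -/
theorem map_twistedCubic_perturb {O : Type v} [CommRing O] (π : O →+* k) {ϖ : O} (hπϖ : π ϖ = 0)
    (h : MvPolynomial (Fin 4) O) :
    ((!![X 0, X 1; X 1, X 2; X 2, X 3 + C ϖ * h] : Matrix (Fin 3) (Fin 2) (MvPolynomial (Fin 4) O))).map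
        (MvPolynomial.map π) =
      (!![X 0, X 1; X 1, X 2; X 2, X 3] : Matrix (Fin 3) (Fin 2) (MvPolynomial (Fin 4) k)) := by
  ext i j
  fin_cases i <;> fin_cases j <;> simp [map_X, map_C, hπϖ]

end TwistedCubic

section TwistedCubicJacobian

/-! ## Jacobian pairs and the chart dichotomy (rev 2; preparation for the scheme-level specimen SPECIMEN-TC3)

On the chart `x₀ ≠ 0` the pair `(Δ₁, Δ₂)` has Jacobian minor `x₀²` w.r.t. `(x₃, x₂)`; on `x₃ ≠ 0` the pair `(Δ₁, Δ₀)` has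
Jacobian minor `x₃²` w.r.t. `(x₀, x₁)`; and every prime through the quadrics missing some variable misses `x₀` or `x₃` —
so the twisted cubic is smooth of codimension two in the «Jacobian pair» sense of res-type-097's proposed v6′ downstairs
clause (2026-08-27T10:16:58Z), whatever binder shape TARGET-DETNOSE finally fixes. -/

variable (k : Type u) [Field k]

/-- `∂₃Δ₁ · ∂₂Δ₂ − ∂₂Δ₁ · ∂₃Δ₂ = x₀²` for `Δ₁ = x₀x₃ − x₁x₂`, `Δ₂ = x₀x₂ − x₁²`: the Jacobian pair on the chart `x₀ ≠ 0`.
[folklore] [OURS · L1 W4.5b] -/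
theorem jacobian_pair_twistedCubic_x0 :
    (pderiv 3 (X 0 * X 3 - X 1 * X 2 : MvPolynomial (Fin 4) k)) * (pderiv 2 (X 0 * X 2 - X 1 * X 1 : MvPolynomial (Fin 4) k))
      - (pderiv 2 (X 0 * X 3 - X 1 * X 2 : MvPolynomial (Fin 4) k)) *
        (pderiv 3 (X 0 * X 2 - X 1 * X 1 : MvPolynomial (Fin 4) k)) = X 0 ^ 2 := by
  simp only [map_sub, Derivation.leibniz, pderiv_X_self, smul_eq_mul,
    pderiv_X_of_ne (show (0 : Fin 4) ≠ 3 by decide), pderiv_X_of_ne (show (1 : Fin 4) ≠ 3 by decide),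
    pderiv_X_of_ne (show (2 : Fin 4) ≠ 3 by decide), pderiv_X_of_ne (show (0 : Fin 4) ≠ 2 by decide),
    pderiv_X_of_ne (show (1 : Fin 4) ≠ 2 by decide), pderiv_X_of_ne (show (3 : Fin 4) ≠ 2 by decide)]
  ring

/-- `∂₀Δ₁ · ∂₁Δ₀ − ∂₁Δ₁ · ∂₀Δ₀ = x₃²` for `Δ₁ = x₀x₃ − x₁x₂`, `Δ₀ = x₁x₃ − x₂²`: the Jacobian pair on the chart `x₃ ≠ 0`.
[folklore] [OURS · L1 W4.5b] -/
theorem jacobian_pair_twistedCubic_x3 :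
    (pderiv 0 (X 0 * X 3 - X 1 * X 2 : MvPolynomial (Fin 4) k)) * (pderiv 1 (X 1 * X 3 - X 2 * X 2 : MvPolynomial (Fin 4) k))
      - (pderiv 1 (X 0 * X 3 - X 1 * X 2 : MvPolynomial (Fin 4) k)) *
        (pderiv 0 (X 1 * X 3 - X 2 * X 2 : MvPolynomial (Fin 4) k)) = X 3 ^ 2 := by
  simp only [map_sub, Derivation.leibniz, pderiv_X_self, smul_eq_mul,
    pderiv_X_of_ne (show (3 : Fin 4) ≠ 0 by decide), pderiv_X_of_ne (show (1 : Fin 4) ≠ 0 by decide),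
    pderiv_X_of_ne (show (2 : Fin 4) ≠ 0 by decide), pderiv_X_of_ne (show (0 : Fin 4) ≠ 1 by decide),
    pderiv_X_of_ne (show (3 : Fin 4) ≠ 1 by decide), pderiv_X_of_ne (show (2 : Fin 4) ≠ 1 by decide)]
  ring

/-- If a prime ideal of `k[x₀,…,x₃]` contains the three quadrics and both `x₀` and `x₃`, it contains every variable
(`x₁² = x₀x₂ − Δ₂`, `x₂² = x₁x₃ − Δ₀`). [folklore] [OURS · L1 W4.5b] -/
theorem forall_X_mem_of_minors_mem {P : Ideal (MvPolynomial (Fin 4) k)} (hP : P.IsPrime)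
    (h0 : (X 1 * X 3 - X 2 * X 2 : MvPolynomial (Fin 4) k) ∈ P)
    (h2 : (X 0 * X 2 - X 1 * X 1 : MvPolynomial (Fin 4) k) ∈ P)
    (hx0 : (X 0 : MvPolynomial (Fin 4) k) ∈ P) (hx3 : (X 3 : MvPolynomial (Fin 4) k) ∈ P) (i : Fin 4) :
    (X i : MvPolynomial (Fin 4) k) ∈ P := by
  have hx1 : (X 1 : MvPolynomial (Fin 4) k) ∈ P := by
    have h : (X 1 * X 1 : MvPolynomial (Fin 4) k) ∈ P := by
      have h' : (X 1 * X 1 : MvPolynomial (Fin 4) k) = X 0 * X 2 - (X 0 * X 2 - X 1 * X 1) := by ring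
      rw [h']
      exact P.sub_mem (P.mul_mem_right _ hx0) h2
    exact (hP.mem_or_mem h).elim id id
  have hx2 : (X 2 : MvPolynomial (Fin 4) k) ∈ P := by
    have h : (X 2 * X 2 : MvPolynomial (Fin 4) k) ∈ P := by
      have h' : (X 2 * X 2 : MvPolynomial (Fin 4) k) = X 1 * X 3 - (X 1 * X 3 - X 2 * X 2) := by ring
      rw [h']
      exact P.sub_mem (P.mul_mem_left _ hx3) h0
    exact (hP.mem_or_mem h).elim id id
  fin_cases i
  · exact hx0
  · exact hx1
  · exact hx2
  · exact hx3

/-- Dichotomy for primes through the twisted cubic's quadrics that miss some variable: `x₀ ∉ P` or `x₃ ∉ P`.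
[folklore] [OURS · L1 W4.5b] -/
theorem X_zero_notMem_or_X_three_notMem {P : Ideal (MvPolynomial (Fin 4) k)} (hP : P.IsPrime)
    (h0 : (X 1 * X 3 - X 2 * X 2 : MvPolynomial (Fin 4) k) ∈ P)
    (h2 : (X 0 * X 2 - X 1 * X 1 : MvPolynomial (Fin 4) k) ∈ P)
    (hrel : ∃ i : Fin 4, (X i : MvPolynomial (Fin 4) k) ∉ P) :
    (X 0 : MvPolynomial (Fin 4) k) ∉ P ∨ (X 3 : MvPolynomial (Fin 4) k) ∉ P := by
  by_contra h
  rw [not_or, not_not, not_not] at h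
  obtain ⟨i, hi⟩ := hrel
  exact hi (forall_X_mem_of_minors_mem k hP h0 h2 h.1 h.2 i)

end TwistedCubicJacobian

end Summit.ResolutionOfSingularities.ResolutionOfSingularities.Cruxes.EquisingularLiftNat.Sections
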